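/-
Copyright (c) 2026 the pub-hodgecm-mathlib formalisation cell (harness21).  Prover seat hodgecm-mathlib-B-p14 (g33), 2026-09-01.  Opportunistic brick
«R1LL-WILD (W′2)» (A-p12 (g19) census `F0/P3a/A-p12/g19/CENSUS-R1LL-wild` 822e2006 §2; LEAD F0P3a-plan (g10) WORD T9-22 (4)): the weighted fixed-point
unfolding of an orbital integral READ ON A TRANSITIVE ACTION (vertices ∕ edges of a tree), by orbit-map transport.
-/
import Literature.NumberTheory.Automorphic.OrbitalIntegralFixedPointWeighted   -- ★ p843030 (F0P2-p01): `integral_conj_eq_smul_finsum_fixedBy{,_of_isClosed}`, `classOrbitalIntegral_eq_sum_fixedBy_of_support_subset_of_conj_invariant`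
import Literature.NumberTheory.Automorphic.OrbitalIntegralDepthExpansion        -- ★ (F0P2-p01): `finsum_mem_eq_ncard_smul_add_sum_ncard_smul` (regrouping a finite sum by a truncated depth)
import Literature.GroupTheory.FixedPointsOrbitMapTransport                      -- (this seat, W′2 pure half): `finsum_mem_fixedBy_quotient_conj_eq_finsum_fixedPoints_of_vertexAction`, `…_of_edgeAction`, `finite_…`
import Literature.GroupTheory.FixedPointsShellValueLaw                           -- (this seat, ED. 2): `finsum_mem_fixedBy_quotient_conj_eq_sum_ncard_shell_smul_of_vertexAction` (shell value law + regrouping)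
import HarnessLib

/-!
# The weighted fixed-point unfolding of an orbital integral, read on a transitive action
# `∫_G φ(g γ g⁻¹) dν(g) = ν(K) · Σ_{x ∈ Fix_W(γ)} val x` — orbit-map transport of ★ `OrbitalIntegralFixedPointWeighted`

Topic `NumberTheory/Automorphic`; namespace `Literature.NumberTheory.Automorphic` (that of ★ I-3 `OrbitalIntegralFixedPointWeighted`).  THEOREMS ONLY (no definition,
no instance, no notation, no named fact, no `sorry`); kernel lane.  Cell `pub/hodgecm-mathlib`, crux H413 = stmt-HodgeConjecture-24833; opportunistic brick
«R1LL-WILD (W′2)» of A-p12 (g19)'s census of the wildly ramified residue of the rank-one unstable transfer letter (LEAD T9-22 (4)); sibling bricks (W′1) «torus in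
the tree» (A-p17 (g23)), (W′3) «class at a shell-`m` vertex» (p08 (g15)), (W′4) «deep shells cancel» (A-p12 ∕ A-p01).  The pure transport is
★ `Literature/GroupTheory/FixedPointsOrbitMapTransport`.
HONEST LABEL: HC_CM is proved only modulo the cell's remaining named inputs (hLiu418, h413) until rung 0 closes; this file is generic measure bookkeeping,
unconditional, and cites print only for orientation.

THE MATHEMATICS [Rogawski1990 §4.9 p. 54; Kottwitz1986 §3; Laumon1995 Lemma (5.3.2); Serre1980Trees I.6.1; LabesseLanglands1979 §2 p. 8].  ★ I-3 unfolds an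
orbital integral of a test function `φ` supported in an open subgroup `K` and invariant under `K`-conjugation as a sum over the `γ`-fixed COSETS:
`∫_G φ(g γ g⁻¹) dν(g) = ν(K) · Σ_{q ∈ Fix_γ(G⧸K)} φ(q.out⁻¹ γ q.out)`.  When `K = Stab(x₀)` is the stabiliser of a point of a transitive `G`-set `W` — a vertex
(or an edge) of the Bruhat–Tits tree on which a `p`-adic group acts — the orbit map `g ↦ g·x₀` identifies the fixed cosets with the fixed POINTS
`Fix_W(γ) = {x | γ·x = x}` and the summand at a coset `gK` with `γ·(g x₀) = g x₀` with «the class of `γ` read at the vertex `g x₀`».  So for ANY value law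
`val : W → E` with `φ(g⁻¹ γ g) = val (g·x₀)` whenever `γ` fixes `g·x₀` (this hypothesis carries both the `K`-invariance and the geometry; no section of the orbit
map is chosen):
  `∫_G φ(g γ g⁻¹) dν(g) = ν(K) · Σ_{x ∈ Fix_W(γ)} val x`,   `classOrbitalIntegral m φ ⟦γ⟧ = ν(K) · Σ_{x ∈ Fix_W(γ)} val x`
(the latter for a canonical family at a compact centraliser, ★ I-3 §3).  This is the shape in which Labesse–Langlands compute the orbital integrals of `SL₂` at an
elliptic torus (§2 p. 8: the vertices `diag(1, ϖ^m)·v₀`, shell by shell) and in which Kottwitz reads Euler–Poincaré functions (the COUNT case `val = 1` is ★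
`TreeActionEulerRelation`, B-p14 (g32)).  Regrouping the facet sum by a DEPTH `d : W → ℕ` (distance to the base facet) under a value law `val x = w (min (d x) m)`
is ★ `finsum_mem_eq_ncard_smul_add_sum_ncard_smul` (the (W′4) entry point).

* §1 vertices (`Kv = Stab(x₀)`, one orbit): **`integral_conj_eq_smul_finsum_fixedPoints_of_vertexAction`** (+ `_of_isClosed`),
  `integral_conj_eq_smul_depthExpansion_of_vertexAction`; edges (`Ke = Stab{x₀, x₁}` set-wise, one dart orbit):
  `integral_conj_eq_smul_finsum_fixedEdges_of_edgeAction_of_isClosed`.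
* §2 class reading (canonical family; ROAD W ∕ (R2) currency): **`classOrbitalIntegral_eq_smul_finsum_fixedPoints_of_vertexAction`**,
  `classOrbitalIntegral_eq_smul_depthExpansion_of_vertexAction`, `classOrbitalIntegral_eq_smul_finsum_fixedEdges_of_edgeAction`.
* §3 (ED. 2) THE SHELL SUMS (Labesse–Langlands' `∫_{T∖G̃} f(x̃⁻¹γx̃) = Σ_m C_m(γ)·f(α_m⁻¹ γ α_m)`, over ★ `FixedPointsShellValueLaw`): if every fixed vertex is
  `act (t · r_{d x}) x₀` with `t γ = γ t`, then **`integral_conj_eq_smul_sum_shells_of_vertexAction`** :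
  `∫_G φ (g γ g⁻¹) dν = ν(Kv) · Σ_{i ≤ N} #{x ∈ Fix_W(γ) | d x = i} • φ (r_i⁻¹ γ r_i)` (+ `_of_isClosed`, + `classOrbitalIntegral_eq_smul_sum_shells_of_vertexAction`).

What is NOT here: any particular group, tree or place (the instantiation at `U(Φ₂)(E_w)` ∕ `GL₂(F_v)` on ★ `latticeTree` is the consumers' one-liner
`act := fun u => glVertexAct hϖ (ρ u)`); the value law itself ((W′3)); the identification of `Fix_W` with a ball ((W′1)).

## References
* [Rogawski1990] J. D. Rogawski, *Automorphic Representations of Unitary Groups in Three Variables*, Ann. of Math. Stud. 123 (1990): §4.9 p. 54.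
* [Kottwitz1986] R. E. Kottwitz, *Base change for unit elements of Hecke algebras*, Compositio Math. 60 (1986): §3.
* [Laumon1995] G. Laumon, *Cohomology of Drinfeld Modular Varieties* I (1996): Lemma (5.3.2) p. 136.
* [Serre1980Trees] J.-P. Serre, *Trees* (1980): Ch. I §6.1, Ch. II §1.2–1.3.
* [LabesseLanglands1979] J.-P. Labesse, R. P. Langlands, *L-indistinguishability for SL(2)*, Canad. J. Math. 31 (1979): §2 p. 8.
-/

set_option autoImplicit false

noncomputable section

open MeasureTheory Measure Topology Filter Set Function MulAction
open Literature.MeasureTheory.Group Literature.GroupTheory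
open scoped ENNReal NNReal Pointwise

namespace Literature.NumberTheory.Automorphic

/-! ## §1 The orbital readings on vertices and edges (over ★ `OrbitalIntegralFixedPointWeighted`) -/

section Integral

variable {G : Type*} [Group G] [TopologicalSpace G] [IsTopologicalGroup G] [MeasurableSpace G] [BorelSpace G]
  (ν : Measure G) [ν.IsMulRightInvariant]
  {E : Type*} [NormedAddCommGroup E] [NormedSpace ℝ E] [CompleteSpace E]
  {W : Type*} (act : G → W → W) (act_one : ∀ x : W, act 1 x = x) (act_mul : ∀ (g h : G) (x : W), act (g * h) x = act g (act h x))
  {x₀ : W} (hV : ∀ x : W, ∃ g : G, act g x₀ = x) (Kv : Subgroup G) (hKv : ∀ g : G, g ∈ Kv ↔ act g x₀ = x₀) (γ : G)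

include act_one act_mul hV hKv in
/-- **THE WEIGHTED ORBITAL INTEGRAL IS A SUM OVER THE FIXED VERTICES**: for `Kv = Stab(x₀)` open of finite mass, `ν` right-invariant, `φ` supported in `Kv` and
`Kv`-conjugation invariant, finitely many fixed vertices, and a value law `φ (g⁻¹ γ g) = val (act g x₀)` at the fixed vertices `act g x₀`:
`∫_G φ (g γ g⁻¹) dν(g) = ν(Kv) · Σᶠ_{x ∈ Fix_W(γ)} val x` — ★ `integral_conj_eq_smul_finsum_fixedBy` read through §2. [cite: Rogawski1990, §4.9 p. 54]
[cite: Kottwitz1986, §3] [cite: LabesseLanglands1979, §2 p. 8] -/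
theorem integral_conj_eq_smul_finsum_fixedPoints_of_vertexAction (hK : IsOpen (Kv : Set G)) (hKν : ν Kv ≠ ⊤)
    (φ : G → E) (hφ : support φ ⊆ (Kv : Set G)) (hφK : ∀ k ∈ Kv, ∀ y : G, φ (k * y * k⁻¹) = φ y)
    (hfin : {x : W | act γ x = x}.Finite) (val : W → E) (hval : ∀ g : G, act γ (act g x₀) = act g x₀ → φ (g⁻¹ * γ * g) = val (act g x₀)) :
    ∫ g, φ (g * γ * g⁻¹) ∂ν = ν.real (Kv : Set G) • ∑ᶠ x ∈ {x : W | act γ x = x}, val x := by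
  rw [integral_conj_eq_smul_finsum_fixedBy γ Kv ν hK hKν φ hφ hφK
      ((finite_fixedBy_quotient_iff_of_vertexAction act act_one act_mul hV Kv hKv γ).2 hfin),
    finsum_mem_fixedBy_quotient_conj_eq_finsum_fixedPoints_of_vertexAction act act_one act_mul hV Kv hKv γ φ val hval]

include act_one act_mul hV hKv in
/-- **The same at a CLOSED class with COMPACT centraliser** (`Kv` compact open; the fixed-vertex set is then finite, ★ `finite_fixedBy_quotient_of_isClosed`).
[cite: Rogawski1990, §4.9 p. 54] [cite: Kottwitz1986, §3] -/
theorem integral_conj_eq_smul_finsum_fixedPoints_of_vertexAction_of_isClosed [LocallyCompactSpace G] [SecondCountableTopology G] [T2Space G]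
    [IsFiniteMeasureOnCompacts ν] [CompactSpace (Subgroup.centralizer ({γ} : Set G))] (hO : IsClosed {g : G | ∃ y : G, y * γ * y⁻¹ = g})
    (hK : IsOpen (Kv : Set G)) (hKc : IsCompact (Kv : Set G)) (φ : G → E) (hφ : support φ ⊆ (Kv : Set G))
    (hφK : ∀ k ∈ Kv, ∀ y : G, φ (k * y * k⁻¹) = φ y)
    (val : W → E) (hval : ∀ g : G, act γ (act g x₀) = act g x₀ → φ (g⁻¹ * γ * g) = val (act g x₀)) :
    ∫ g, φ (g * γ * g⁻¹) ∂ν = ν.real (Kv : Set G) • ∑ᶠ x ∈ {x : W | act γ x = x}, val x := by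
  rw [integral_conj_eq_smul_finsum_fixedBy_of_isClosed γ Kv ν hO hK hKc φ hφ hφK,
    finsum_mem_fixedBy_quotient_conj_eq_finsum_fixedPoints_of_vertexAction act act_one act_mul hV Kv hKv γ φ val hval]

include act_one act_mul hV hKv in
/-- **THE DEPTH EXPANSION ON THE VERTICES** (the (W′4) entry point): if at every fixed vertex `x = act g x₀` the value `φ (g⁻¹ γ g) = w (min (d x) m)` depends only
on a truncated DEPTH `d : W → ℕ` (distance to the base facet, shells `d = i`), then
`∫_G φ (g γ g⁻¹) dν(g) = ν(Kv) · ( #{x ∈ Fix_W(γ) | m ≤ d x} · w m + Σ_{i<m} #{x ∈ Fix_W(γ) | d x = i} · w i )` — ★ `finsum_mem_eq_ncard_smul_add_sum_ncard_smul`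
on the facet sum. [cite: LabesseLanglands1979, §2 p. 8] [cite: Rogawski1990, §4.9 p. 54] [cite: Laumon1995, Lemma (5.3.2) p. 136] -/
theorem integral_conj_eq_smul_depthExpansion_of_vertexAction (hK : IsOpen (Kv : Set G)) (hKν : ν Kv ≠ ⊤)
    (φ : G → E) (hφ : support φ ⊆ (Kv : Set G)) (hφK : ∀ k ∈ Kv, ∀ y : G, φ (k * y * k⁻¹) = φ y)
    (hfin : {x : W | act γ x = x}.Finite) (d : W → ℕ) (m : ℕ) (w : ℕ → E)
    (hval : ∀ g : G, act γ (act g x₀) = act g x₀ → φ (g⁻¹ * γ * g) = w (min (d (act g x₀)) m)) :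
    ∫ g, φ (g * γ * g⁻¹) ∂ν =
      ν.real (Kv : Set G) • ({x : W | act γ x = x ∧ m ≤ d x}.ncard • w m +
        ∑ i ∈ Finset.range m, {x : W | act γ x = x ∧ d x = i}.ncard • w i) := by
  rw [integral_conj_eq_smul_finsum_fixedPoints_of_vertexAction ν act act_one act_mul hV Kv hKv γ hK hKν φ hφ hφK hfin
      (fun x => w (min (d x) m)) hval,
    finsum_mem_eq_ncard_smul_add_sum_ncard_smul hfin (fun x => w (min (d x) m)) d m w fun _ _ => rfl]
  simp only [Set.sep_setOf]

end Integral

section EdgeIntegral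

variable {G : Type*} [Group G] [TopologicalSpace G] [IsTopologicalGroup G] [MeasurableSpace G] [BorelSpace G]
  (ν : Measure G) [ν.IsMulRightInvariant]
  {E : Type*} [NormedAddCommGroup E] [NormedSpace ℝ E] [CompleteSpace E]
  {W : Type*} {X : SimpleGraph W} (act : G → W → W) (act_one : ∀ x : W, act 1 x = x)
  (act_mul : ∀ (g h : G) (x : W), act (g * h) x = act g (act h x))
  (act_adj : ∀ (g : G) (a b : W), X.Adj (act g a) (act g b) ↔ X.Adj a b)
  {x₀ x₁ : W} (h01 : X.Adj x₀ x₁) (hD : ∀ a b : W, X.Adj a b → ∃ g : G, act g x₀ = a ∧ act g x₁ = b)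
  (Ke : Subgroup G) (hKe : ∀ g : G, g ∈ Ke ↔ s(act g x₀, act g x₁) = s(x₀, x₁)) (γ : G)

include act_one act_mul act_adj hD hKe in
/-- **THE WEIGHTED ORBITAL INTEGRAL IS A SUM OVER THE SET-WISE FIXED EDGES** (edge-stabiliser level `Ke = Stab{x₀, x₁}` compact open, closed class, compact
centraliser): `∫_G φ (g γ g⁻¹) dν(g) = ν(Ke) · Σᶠ_{e ∈ E(X), γ·e = e} val e` under the value law at the fixed edges. [cite: Rogawski1990, §4.9 p. 54]
[cite: Kottwitz1986, §3] [cite: Serre1980Trees, II.1.2–1.3] -/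
theorem integral_conj_eq_smul_finsum_fixedEdges_of_edgeAction_of_isClosed [LocallyCompactSpace G] [SecondCountableTopology G] [T2Space G]
    [IsFiniteMeasureOnCompacts ν] [CompactSpace (Subgroup.centralizer ({γ} : Set G))] (hO : IsClosed {g : G | ∃ y : G, y * γ * y⁻¹ = g})
    (hK : IsOpen (Ke : Set G)) (hKc : IsCompact (Ke : Set G)) (φ : G → E) (hφ : support φ ⊆ (Ke : Set G))
    (hφK : ∀ k ∈ Ke, ∀ y : G, φ (k * y * k⁻¹) = φ y) (val : X.edgeSet → E)
    (hval : ∀ g : G, Sym2.map (act γ) s(act g x₀, act g x₁) = s(act g x₀, act g x₁) →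
      φ (g⁻¹ * γ * g) = val ⟨s(act g x₀, act g x₁), sym2Mk_act_mem_edgeSet act act_adj g h01⟩) :
    ∫ g, φ (g * γ * g⁻¹) ∂ν = ν.real (Ke : Set G) • ∑ᶠ e ∈ {e : X.edgeSet | Sym2.map (act γ) (e : Sym2 W) = e}, val e := by
  rw [integral_conj_eq_smul_finsum_fixedBy_of_isClosed γ Ke ν hO hK hKc φ hφ hφK,
    finsum_mem_fixedBy_quotient_conj_eq_finsum_fixedEdges_of_edgeAction act act_one act_mul act_adj h01 hD Ke hKe γ φ val hval]

end EdgeIntegral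

/-! ## §2 The class reading for a canonical family (ROAD W ∕ (R2) currency) -/

section Canonical

variable {G : Type*} [Group G] [TopologicalSpace G] [IsTopologicalGroup G] [LocallyCompactSpace G]
  [SecondCountableTopology G] [T2Space G] [MeasurableSpace G] [BorelSpace G]
  [∀ γ : G, MeasurableSpace (G ⧸ Subgroup.centralizer ({γ} : Set G))]
  [∀ γ : G, BorelSpace (G ⧸ Subgroup.centralizer ({γ} : Set G))]
  {E : Type*} [NormedAddCommGroup E] [NormedSpace ℝ E] [CompleteSpace E]
  {W : Type*} (act : G → W → W) (act_one : ∀ x : W, act 1 x = x) (act_mul : ∀ (g h : G) (x : W), act (g * h) x = act g (act h x))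

include act_one act_mul in
/-- **THE CLASS ORBITAL INTEGRAL AS A SUM OVER THE FIXED VERTICES**: for a family `m` canonical for `(P, ν)` (★ `OrbitalMeasureFamily.IsCanonical`), `P γ`, `C_G(γ)`
compact, the class of `γ` closed, `Kv = Stab(x₀)` compact open, `φ` continuous, supported in `Kv` and `Kv`-conjugation invariant, and a value law at the fixed vertices:
`classOrbitalIntegral m φ ⟦γ⟧ = ν(Kv) · Σᶠ_{x ∈ Fix_W(γ)} val x` — ★ `classOrbitalIntegral_eq_sum_fixedBy_of_support_subset_of_conj_invariant` read through §2
(the mass `ν.real Kv` carried, architect RULING A-4 (b)). [cite: Rogawski1990, §4.9 p. 54] [cite: Kottwitz1986, §3] [cite: LabesseLanglands1979, §2 p. 8] -/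
theorem classOrbitalIntegral_eq_smul_finsum_fixedPoints_of_vertexAction {P : G → Prop} (hP : ∀ g x : G, P g → P (x * g * x⁻¹))
    {ν : Measure G} [ν.IsHaarMeasure] [ν.IsMulRightInvariant] {m : OrbitalMeasureFamily G} (hm : m.IsCanonical P ν)
    {γ : G} (hγ : P γ) [CompactSpace (Subgroup.centralizer ({γ} : Set G))]
    {x₀ : W} (hV : ∀ x : W, ∃ g : G, act g x₀ = x) (Kv : Subgroup G) (hKv : ∀ g : G, g ∈ Kv ↔ act g x₀ = x₀)
    (hK : IsOpen (Kv : Set G)) (hKc : IsCompact (Kv : Set G)) (hO : IsClosed {g : G | ∃ y : G, y * γ * y⁻¹ = g})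
    (φ : G → E) (hφc : Continuous φ) (hφ : support φ ⊆ (Kv : Set G)) (hφK : ∀ k ∈ Kv, ∀ y : G, φ (k * y * k⁻¹) = φ y)
    (val : W → E) (hval : ∀ g : G, act γ (act g x₀) = act g x₀ → φ (g⁻¹ * γ * g) = val (act g x₀)) :
    classOrbitalIntegral m φ (ConjClasses.mk γ) = ν.real (Kv : Set G) • ∑ᶠ x ∈ {x : W | act γ x = x}, val x := by
  rw [classOrbitalIntegral_eq_sum_fixedBy_of_support_subset_of_conj_invariant hP hm hγ Kv hK hKc hO φ hφc hφ hφK,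
    finsum_mem_fixedBy_quotient_conj_eq_finsum_fixedPoints_of_vertexAction act act_one act_mul hV Kv hKv γ φ val hval]

include act_one act_mul in
/-- **The class depth expansion on the vertices** ((W′4) entry point, class currency): under a value law `φ (g⁻¹ γ g) = w (min (d (act g x₀)) m)` at the fixed vertices,
`classOrbitalIntegral m φ ⟦γ⟧ = ν(Kv) · ( #{x ∈ Fix_W(γ) | m ≤ d x} · w m + Σ_{i<m} #{x ∈ Fix_W(γ) | d x = i} · w i )`. [cite: LabesseLanglands1979, §2 p. 8]
[cite: Rogawski1990, §4.9 p. 54] [cite: Laumon1995, Lemma (5.3.2) p. 136] -/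
theorem classOrbitalIntegral_eq_smul_depthExpansion_of_vertexAction {P : G → Prop} (hP : ∀ g x : G, P g → P (x * g * x⁻¹))
    {ν : Measure G} [ν.IsHaarMeasure] [ν.IsMulRightInvariant] {m : OrbitalMeasureFamily G} (hm : m.IsCanonical P ν)
    {γ : G} (hγ : P γ) [CompactSpace (Subgroup.centralizer ({γ} : Set G))]
    {x₀ : W} (hV : ∀ x : W, ∃ g : G, act g x₀ = x) (Kv : Subgroup G) (hKv : ∀ g : G, g ∈ Kv ↔ act g x₀ = x₀)
    (hK : IsOpen (Kv : Set G)) (hKc : IsCompact (Kv : Set G)) (hO : IsClosed {g : G | ∃ y : G, y * γ * y⁻¹ = g})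
    (φ : G → E) (hφc : Continuous φ) (hφ : support φ ⊆ (Kv : Set G)) (hφK : ∀ k ∈ Kv, ∀ y : G, φ (k * y * k⁻¹) = φ y)
    (d : W → ℕ) (n : ℕ) (w : ℕ → E)
    (hval : ∀ g : G, act γ (act g x₀) = act g x₀ → φ (g⁻¹ * γ * g) = w (min (d (act g x₀)) n)) :
    classOrbitalIntegral m φ (ConjClasses.mk γ) =
      ν.real (Kv : Set G) • ({x : W | act γ x = x ∧ n ≤ d x}.ncard • w n +
        ∑ i ∈ Finset.range n, {x : W | act γ x = x ∧ d x = i}.ncard • w i) := by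
  have hfin : {x : W | act γ x = x}.Finite :=
    (finite_fixedBy_quotient_iff_of_vertexAction act act_one act_mul hV Kv hKv γ).1 (finite_fixedBy_quotient_of_isClosed γ Kv hO hK hKc)
  rw [classOrbitalIntegral_eq_smul_finsum_fixedPoints_of_vertexAction act act_one act_mul hP hm hγ hV Kv hKv hK hKc hO φ hφc hφ hφK
      (fun x => w (min (d x) n)) hval,
    finsum_mem_eq_ncard_smul_add_sum_ncard_smul hfin (fun x => w (min (d x) n)) d n w fun _ _ => rfl]
  simp only [Set.sep_setOf]

variable {X : SimpleGraph W} (act_adj : ∀ (g : G) (a b : W), X.Adj (act g a) (act g b) ↔ X.Adj a b)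

include act_one act_mul act_adj in
/-- **THE CLASS ORBITAL INTEGRAL AS A SUM OVER THE SET-WISE FIXED EDGES** (edge-stabiliser level `Ke = Stab{x₀, x₁}`, one dart orbit): `classOrbitalIntegral m φ ⟦γ⟧ =
ν(Ke) · Σᶠ_{e ∈ E(X), γ·e = e} val e` under the value law at the fixed edges. [cite: Rogawski1990, §4.9 p. 54] [cite: Kottwitz1986, §3] [cite: Serre1980Trees, II.1.2–1.3] -/
theorem classOrbitalIntegral_eq_smul_finsum_fixedEdges_of_edgeAction {P : G → Prop} (hP : ∀ g x : G, P g → P (x * g * x⁻¹))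
    {ν : Measure G} [ν.IsHaarMeasure] [ν.IsMulRightInvariant] {m : OrbitalMeasureFamily G} (hm : m.IsCanonical P ν)
    {γ : G} (hγ : P γ) [CompactSpace (Subgroup.centralizer ({γ} : Set G))]
    {x₀ x₁ : W} (h01 : X.Adj x₀ x₁) (hD : ∀ a b : W, X.Adj a b → ∃ g : G, act g x₀ = a ∧ act g x₁ = b)
    (Ke : Subgroup G) (hKe : ∀ g : G, g ∈ Ke ↔ s(act g x₀, act g x₁) = s(x₀, x₁))
    (hK : IsOpen (Ke : Set G)) (hKc : IsCompact (Ke : Set G)) (hO : IsClosed {g : G | ∃ y : G, y * γ * y⁻¹ = g})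
    (φ : G → E) (hφc : Continuous φ) (hφ : support φ ⊆ (Ke : Set G)) (hφK : ∀ k ∈ Ke, ∀ y : G, φ (k * y * k⁻¹) = φ y)
    (val : X.edgeSet → E)
    (hval : ∀ g : G, Sym2.map (act γ) s(act g x₀, act g x₁) = s(act g x₀, act g x₁) →
      φ (g⁻¹ * γ * g) = val ⟨s(act g x₀, act g x₁), sym2Mk_act_mem_edgeSet act act_adj g h01⟩) :
    classOrbitalIntegral m φ (ConjClasses.mk γ) =
      ν.real (Ke : Set G) • ∑ᶠ e ∈ {e : X.edgeSet | Sym2.map (act γ) (e : Sym2 W) = e}, val e := by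
  rw [classOrbitalIntegral_eq_sum_fixedBy_of_support_subset_of_conj_invariant hP hm hγ Ke hK hKc hO φ hφc hφ hφK,
    finsum_mem_fixedBy_quotient_conj_eq_finsum_fixedEdges_of_edgeAction act act_one act_mul act_adj h01 hD Ke hKe γ φ val hval]

end Canonical


/-! ## §3 The shell sums (ED. 2; Labesse–Langlands' `Σ_m C_m(γ) f(α_m⁻¹ γ α_m)`, over ★ `FixedPointsShellValueLaw`) -/

section Shells

variable {G : Type*} [Group G] [TopologicalSpace G] [IsTopologicalGroup G] [MeasurableSpace G] [BorelSpace G]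
  (ν : Measure G) [ν.IsMulRightInvariant]
  {E : Type*} [NormedAddCommGroup E] [NormedSpace ℝ E] [CompleteSpace E]
  {W : Type*} (act : G → W → W) (act_one : ∀ x : W, act 1 x = x) (act_mul : ∀ (g h : G) (x : W), act (g * h) x = act g (act h x))
  {x₀ : W} (hV : ∀ x : W, ∃ g : G, act g x₀ = x) (Kv : Subgroup G) (hKv : ∀ g : G, g ∈ Kv ↔ act g x₀ = x₀) (γ : G)

include act_one act_mul hV hKv in
/-- **THE ORBITAL INTEGRAL AS A SHELL SUM**: `Kv = Stab(x₀)` open of finite mass, `φ` supported in `Kv` and `Kv`-conjugation invariant, finitely many fixed vertices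
all of shell index `≤ N`, and every fixed vertex reached as `act (t · r_{d x}) x₀` with `t γ = γ t` (the torus is transitive on each shell, ★ (W′1)); then
`∫_G φ (g γ g⁻¹) dν(g) = ν(Kv) · Σ_{i ≤ N} #{x ∈ Fix_W(γ) | d x = i} • φ (r_i⁻¹ γ r_i)`. [cite: LabesseLanglands1979, §2 p. 8] [cite: Rogawski1990, §4.9 p. 54]
[cite: Kottwitz1986, §3] -/
theorem integral_conj_eq_smul_sum_shells_of_vertexAction (hK : IsOpen (Kv : Set G)) (hKν : ν Kv ≠ ⊤)
    (φ : G → E) (hφ : support φ ⊆ (Kv : Set G)) (hφK : ∀ k ∈ Kv, ∀ y : G, φ (k * y * k⁻¹) = φ y)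
    (hfin : {x : W | act γ x = x}.Finite) (d : W → ℕ) (r : ℕ → G) (N : ℕ)
    (hshell : ∀ x : W, act γ x = x → ∃ t : G, t * γ = γ * t ∧ act (t * r (d x)) x₀ = x) (hN : ∀ x : W, act γ x = x → d x ≤ N) :
    ∫ g, φ (g * γ * g⁻¹) ∂ν = ν.real (Kv : Set G) • ∑ i ∈ Finset.range (N + 1), {x : W | act γ x = x ∧ d x = i}.ncard • φ ((r i)⁻¹ * γ * r i) := by
  rw [integral_conj_eq_smul_finsum_fixedBy γ Kv ν hK hKν φ hφ hφK
      ((finite_fixedBy_quotient_iff_of_vertexAction act act_one act_mul hV Kv hKv γ).2 hfin),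
    finsum_mem_fixedBy_quotient_conj_eq_sum_ncard_shell_smul_of_vertexAction act act_one act_mul Kv hKv γ hV φ hφK d r N hshell hfin hN]

include act_one act_mul hV hKv in
/-- **The same at a CLOSED class with COMPACT centraliser** (`Kv` compact open). [cite: LabesseLanglands1979, §2 p. 8] [cite: Rogawski1990, §4.9 p. 54] -/
theorem integral_conj_eq_smul_sum_shells_of_vertexAction_of_isClosed [LocallyCompactSpace G] [SecondCountableTopology G] [T2Space G]
    [IsFiniteMeasureOnCompacts ν] [CompactSpace (Subgroup.centralizer ({γ} : Set G))] (hO : IsClosed {g : G | ∃ y : G, y * γ * y⁻¹ = g})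
    (hK : IsOpen (Kv : Set G)) (hKc : IsCompact (Kv : Set G)) (φ : G → E) (hφ : support φ ⊆ (Kv : Set G))
    (hφK : ∀ k ∈ Kv, ∀ y : G, φ (k * y * k⁻¹) = φ y) (d : W → ℕ) (r : ℕ → G) (N : ℕ)
    (hshell : ∀ x : W, act γ x = x → ∃ t : G, t * γ = γ * t ∧ act (t * r (d x)) x₀ = x) (hN : ∀ x : W, act γ x = x → d x ≤ N) :
    ∫ g, φ (g * γ * g⁻¹) ∂ν = ν.real (Kv : Set G) • ∑ i ∈ Finset.range (N + 1), {x : W | act γ x = x ∧ d x = i}.ncard • φ ((r i)⁻¹ * γ * r i) := by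
  have hfin : {x : W | act γ x = x}.Finite :=
    (finite_fixedBy_quotient_iff_of_vertexAction act act_one act_mul hV Kv hKv γ).1 (finite_fixedBy_quotient_of_isClosed γ Kv hO hK hKc)
  exact integral_conj_eq_smul_sum_shells_of_vertexAction ν act act_one act_mul hV Kv hKv γ hK hKc.measure_lt_top.ne φ hφ hφK hfin d r N hshell hN

end Shells

section ShellsCanonical

variable {G : Type*} [Group G] [TopologicalSpace G] [IsTopologicalGroup G] [LocallyCompactSpace G]
  [SecondCountableTopology G] [T2Space G] [MeasurableSpace G] [BorelSpace G]
  [∀ γ : G, MeasurableSpace (G ⧸ Subgroup.centralizer ({γ} : Set G))]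
  [∀ γ : G, BorelSpace (G ⧸ Subgroup.centralizer ({γ} : Set G))]
  {E : Type*} [NormedAddCommGroup E] [NormedSpace ℝ E] [CompleteSpace E]
  {W : Type*} (act : G → W → W) (act_one : ∀ x : W, act 1 x = x) (act_mul : ∀ (g h : G) (x : W), act (g * h) x = act g (act h x))

include act_one act_mul in
/-- **THE CLASS ORBITAL INTEGRAL AS A SHELL SUM** (canonical family, `C_G(γ)` compact, class closed, `Kv = Stab(x₀)` compact open, `φ` continuous, supported in `Kv`,
`Kv`-conjugation invariant; shell hypothesis as above): `classOrbitalIntegral m φ ⟦γ⟧ = ν(Kv) · Σ_{i ≤ N} #{x ∈ Fix_W(γ) | d x = i} • φ (r_i⁻¹ γ r_i)`.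
[cite: LabesseLanglands1979, §2 p. 8] [cite: Rogawski1990, §4.9 p. 54] [cite: Kottwitz1986, §3] -/
theorem classOrbitalIntegral_eq_smul_sum_shells_of_vertexAction {P : G → Prop} (hP : ∀ g x : G, P g → P (x * g * x⁻¹))
    {ν : Measure G} [ν.IsHaarMeasure] [ν.IsMulRightInvariant] {m : OrbitalMeasureFamily G} (hm : m.IsCanonical P ν)
    {γ : G} (hγ : P γ) [CompactSpace (Subgroup.centralizer ({γ} : Set G))]
    {x₀ : W} (hV : ∀ x : W, ∃ g : G, act g x₀ = x) (Kv : Subgroup G) (hKv : ∀ g : G, g ∈ Kv ↔ act g x₀ = x₀)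
    (hK : IsOpen (Kv : Set G)) (hKc : IsCompact (Kv : Set G)) (hO : IsClosed {g : G | ∃ y : G, y * γ * y⁻¹ = g})
    (φ : G → E) (hφc : Continuous φ) (hφ : support φ ⊆ (Kv : Set G)) (hφK : ∀ k ∈ Kv, ∀ y : G, φ (k * y * k⁻¹) = φ y)
    (d : W → ℕ) (r : ℕ → G) (N : ℕ)
    (hshell : ∀ x : W, act γ x = x → ∃ t : G, t * γ = γ * t ∧ act (t * r (d x)) x₀ = x) (hN : ∀ x : W, act γ x = x → d x ≤ N) :
    classOrbitalIntegral m φ (ConjClasses.mk γ) =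
      ν.real (Kv : Set G) • ∑ i ∈ Finset.range (N + 1), {x : W | act γ x = x ∧ d x = i}.ncard • φ ((r i)⁻¹ * γ * r i) := by
  have hfin : {x : W | act γ x = x}.Finite :=
    (finite_fixedBy_quotient_iff_of_vertexAction act act_one act_mul hV Kv hKv γ).1 (finite_fixedBy_quotient_of_isClosed γ Kv hO hK hKc)
  rw [classOrbitalIntegral_eq_sum_fixedBy_of_support_subset_of_conj_invariant hP hm hγ Kv hK hKc hO φ hφc hφ hφK,
    finsum_mem_fixedBy_quotient_conj_eq_sum_ncard_shell_smul_of_vertexAction act act_one act_mul Kv hKv γ hV φ hφK d r N hshell hfin hN]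

end ShellsCanonical

end Literature.NumberTheory.Automorphic

end
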